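import Mathlib
import Summits.ValiantsHypothesis.ValiantsHypothesis.Theses.ValuativeGCT

/-!
# Slice bound for row-wise sandwich invariants (B1)

Stub `stub_sliceBound` of line `skew-restriction-rank` for crux `ValuativeGCT.ValuativeFlip`
(stmt-ValiantsHypothesis-12624): `dim (Hom_D ∩ sandInv_n) ≤ (D+1)^(n⁴-2n²+2n)` for the row-wise
`SL_n × SL_n` sandwich action on `(Mat_n)^{n²}`.  Proof: Krylov/companion normal form of a generic
pair of slots under a unimodular sandwich, Zariski density (`MvPolynomial.funext`), restriction to
the linear slice (`aeval` of a coordinate projection, injective on invariants), monomial count.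
Everything is elementary linear algebra over `ℂ`; no named facts are used.
-/

set_option linter.dupNamespace false

namespace Summit.ValiantsHypothesis.ValiantsHypothesis.Theorems.ValuativeFlip

open MvPolynomial
open scoped BigOperators Matrix
open Literature.NumberTheory.DiophantineGeometry

noncomputable section

section Krylov

variable {R : Type*} [CommRing R] {N : ℕ} [NeZero N]

/-- Krylov matrix of `B` with respect to `e₀`: entry `(a, k)` is `(B ^ k) a 0`, i.e. column `k`
is `B ^ k • e₀`. [folklore] -/
def sbKry (B : Matrix (Fin N) (Fin N) R) : Matrix (Fin N) (Fin N) R :=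
  Matrix.of fun a k => (B ^ (k : ℕ)) a 0

/-- The Krylov matrix commutes with ring homomorphisms. [folklore] -/
theorem sbKry_map {S : Type*} [CommRing S] (f : R →+* S) (B : Matrix (Fin N) (Fin N) R) :
    (sbKry B).map f = sbKry (B.map f) := by
  ext a k
  simp only [sbKry, Matrix.map_apply, Matrix.of_apply]
  rw [← Matrix.map_pow, Matrix.map_apply]

/-- Column `k + 1` of the Krylov matrix is `B` times column `k`. [folklore] -/
theorem sbKry_mul_apply (B : Matrix (Fin N) (Fin N) R) (a k : Fin N) (hk : (k : ℕ) + 1 < N) :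
    (B * sbKry B) a k = sbKry B a ⟨(k : ℕ) + 1, hk⟩ := by
  simp only [sbKry, Matrix.mul_apply, Matrix.of_apply]
  rw [pow_succ', Matrix.mul_apply]

/-- Companion normal form: if the Krylov matrix `K` of `B` is invertible then the first `N - 1`
columns of `K⁻¹ B K` are `e₁, …, e_{N-1}`. [folklore: rational canonical form of a cyclic matrix] -/
theorem sbKry_conj_apply {K : Type*} [Field K] (B : Matrix (Fin N) (Fin N) K)
    (h : (sbKry B).det ≠ 0) (a k : Fin N) (hk : (k : ℕ) + 1 < N) :
    ((sbKry B)⁻¹ * B * sbKry B) a k = if (a : ℕ) = k + 1 then 1 else 0 := by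
  rw [Matrix.mul_assoc, Matrix.mul_apply]
  simp_rw [sbKry_mul_apply B _ k hk]
  rw [← Matrix.mul_apply, Matrix.nonsing_inv_mul _ (isUnit_iff_ne_zero.mpr h), Matrix.one_apply]
  simp only [Fin.ext_iff]

variable (R N) in
/-- The lower shift matrix `S e_k = e_{k+1}`. [folklore] -/
def sbShift : Matrix (Fin N) (Fin N) R :=
  Matrix.of fun a b => if (a : ℕ) = b + 1 then 1 else 0

/-- Powers of the shift: `(S ^ k) a 0 = [a = k]` for `k < N`. [folklore] -/
theorem sbShift_pow_apply_zero (k : ℕ) (hk : k < N) (a : Fin N) :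
    (sbShift R N ^ k) a 0 = if a = ⟨k, hk⟩ then 1 else 0 := by
  induction k generalizing a with
  | zero => simp only [pow_zero, Matrix.one_apply, Fin.ext_iff, Fin.val_zero]
  | succ k ih =>
    rw [pow_succ', Matrix.mul_apply, Finset.sum_eq_single ⟨k, by omega⟩]
    · rw [ih (by omega)]
      simp [sbShift, Fin.ext_iff]
    · intro b _ hb
      rw [ih (by omega)]
      simp [hb]
    · simp

/-- The Krylov matrix of the shift is the identity. [folklore] -/
theorem sbKry_shift : sbKry (sbShift R N) = 1 := by
  ext a k
  rw [sbKry, Matrix.of_apply, sbShift_pow_apply_zero k k.2, Matrix.one_apply]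

end Krylov

/-- The `j`-th slot of a point `x : MatIdx N × MatIdx N → A`: the `N × N` matrix
`(c, d) ↦ x (j, toLex (c, d))`. [folklore] -/
def sbSlot {N : ℕ} {A : Type*} (x : MatIdx N × MatIdx N → A) (j : MatIdx N) :
    Matrix (Fin N) (Fin N) A :=
  Matrix.of fun c d => x (j, toLex (c, d))

/-- The sandwich substitution of the route: `X (j, i) ↦ ∑_l P i₁ l₁ Q l₂ i₂ • X (j, l)`. [folklore] -/
def sbSubst {N : ℕ} (P Q : Matrix (Fin N) (Fin N) ℂ) :
    MatIdx N × MatIdx N → MvPolynomial (MatIdx N × MatIdx N) ℂ :=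
  fun p => ∑ l : MatIdx N, (P (ofLex p.2).1 (ofLex l).1 * Q (ofLex l).2 (ofLex p.2).2) •
    (X (p.1, l) : MvPolynomial (MatIdx N × MatIdx N) ℂ)

/-- The row-wise sandwich action on points: slot `j` of `sbSand P Q x` is `P * x_j * Q`. [folklore] -/
def sbSand {N : ℕ} (P Q : Matrix (Fin N) (Fin N) ℂ) (x : MatIdx N × MatIdx N → ℂ) :
    MatIdx N × MatIdx N → ℂ :=
  fun p => (P * sbSlot x p.1 * Q) (ofLex p.2).1 (ofLex p.2).2

/-- Slots of the sandwiched point. [folklore] -/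
theorem sbSlot_sbSand {N : ℕ} (P Q : Matrix (Fin N) (Fin N) ℂ) (x : MatIdx N × MatIdx N → ℂ)
    (j : MatIdx N) : sbSlot (sbSand P Q x) j = P * sbSlot x j * Q := by
  ext c d
  simp only [sbSlot, sbSand, Matrix.of_apply, ofLex_toLex]

/-- `eval x (aeval f G) = eval (fun p ↦ eval x (f p)) G`. [folklore] -/
theorem sb_eval_aeval {σ τ : Type*} (x : τ → ℂ) (f : σ → MvPolynomial τ ℂ) (G : MvPolynomial σ ℂ) :
    eval x (aeval f G) = eval (fun p => eval x (f p)) G :=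
  eval₂Hom_bind₁ _ _ _ _

/-- Evaluating the sandwich substitution is evaluating at the sandwiched point. [folklore] -/
theorem eval_aeval_sbSubst {N : ℕ} (P Q : Matrix (Fin N) (Fin N) ℂ)
    (x : MatIdx N × MatIdx N → ℂ) (G : MvPolynomial (MatIdx N × MatIdx N) ℂ) :
    eval x (aeval (sbSubst P Q) G) = eval (sbSand P Q x) G := by
  rw [sb_eval_aeval]
  congr 2
  funext p
  simp only [sbSubst, sbSand, map_sum, smul_eval, eval_X, Matrix.mul_apply, sbSlot, Matrix.of_apply]
  rw [← Equiv.sum_comp (toLex : Fin N × Fin N ≃ MatIdx N), Fintype.sum_prod_type, Finset.sum_comm]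
  refine Finset.sum_congr rfl fun b _ => ?_
  rw [Finset.sum_mul]
  refine Finset.sum_congr rfl fun a _ => ?_
  simp only [ofLex_toLex]
  ring

/-- Slots of the generic point evaluate to slots. [folklore] -/
theorem sbSlot_map_eval {N : ℕ} (x : MatIdx N × MatIdx N → ℂ) (j : MatIdx N) :
    (sbSlot (fun p => (X p : MvPolynomial (MatIdx N × MatIdx N) ℂ)) j).map (eval x) =
      sbSlot x j := by
  ext c d
  simp only [sbSlot, Matrix.map_apply, Matrix.of_apply, eval_X]

variable (m : ℕ)

/-- First distinguished row slot `j₀ = (0,0)`. [folklore] -/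
def sbJ0 : MatIdx (m + 2) := toLex (0, 0)

/-- Second distinguished row slot `j₁ = (0,1)`. [folklore] -/
def sbJ1 : MatIdx (m + 2) := toLex (0, 1)

/-- `j₀ ≠ j₁`. [folklore] -/
theorem sbJ0_ne_sbJ1 : sbJ0 m ≠ sbJ1 m := by
  simp [sbJ0, sbJ1]

/-- The density polynomial `h = det X_{j₀} · det K(X_{j₁} adj X_{j₀})`. [folklore] -/
def sbH : MvPolynomial (MatIdx (m + 2) × MatIdx (m + 2)) ℂ :=
  (sbSlot (fun p => X p) (sbJ0 m)).det *
    (sbKry (sbSlot (fun p => X p) (sbJ1 m) * (sbSlot (fun p => X p) (sbJ0 m)).adjugate)).det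

/-- Evaluation of the density polynomial. [folklore] -/
theorem eval_sbH (x : MatIdx (m + 2) × MatIdx (m + 2) → ℂ) :
    eval x (sbH m) = (sbSlot x (sbJ0 m)).det *
      (sbKry (sbSlot x (sbJ1 m) * (sbSlot x (sbJ0 m)).adjugate)).det := by
  simp only [sbH, map_mul, RingHom.map_det, RingHom.mapMatrix_apply, sbKry_map, Matrix.map_mul]
  rw [← RingHom.mapMatrix_apply (eval x) (sbSlot _ _).adjugate, RingHom.map_adjugate,
    RingHom.mapMatrix_apply, sbSlot_map_eval, sbSlot_map_eval]

/-- The test point: slot `j₁` is the shift, all other slots are the identity. [folklore] -/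
def sbTest : MatIdx (m + 2) × MatIdx (m + 2) → ℂ :=
  fun p => (if p.1 = sbJ1 m then sbShift ℂ (m + 2) else (1 : Matrix (Fin (m + 2)) (Fin (m + 2)) ℂ))
    (ofLex p.2).1 (ofLex p.2).2

/-- Slots of the test point. [folklore] -/
theorem sbSlot_sbTest (j : MatIdx (m + 2)) :
    sbSlot (sbTest m) j = if j = sbJ1 m then sbShift ℂ (m + 2) else 1 := by
  ext c d
  simp only [sbSlot, sbTest, Matrix.of_apply, ofLex_toLex]

/-- The density polynomial is nonzero: it is `1` at the test point. [folklore] -/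
theorem sbH_ne_zero : sbH m ≠ 0 := fun h => by
  have := eval_sbH m (sbTest m)
  rw [h, map_zero, sbSlot_sbTest, sbSlot_sbTest, if_neg (sbJ0_ne_sbJ1 m), if_pos rfl,
    Matrix.det_one, Matrix.adjugate_one, Matrix.mul_one, sbKry_shift, Matrix.det_one, one_mul] at this
  exact zero_ne_one this

/-- The slice variables: two scalars, the last column of slot `j₁`, and all entries of the
slots `j ∉ {j₀, j₁}`. [folklore] -/
abbrev sbVar : Type :=
  (Unit ⊕ Unit) ⊕ (Fin (m + 2) ⊕
    {p : MatIdx (m + 2) × MatIdx (m + 2) // ¬(p.1 = sbJ0 m ∨ p.1 = sbJ1 m)})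

/-- The linear coordinate projection onto the slice: `X (j₀, (c,d)) ↦ [c = d] u₀`,
`X (j₁, (c, last)) ↦ v_c`, `X (j₁, (c, d)) ↦ [c = d + 1] u₁` for `d ≠ last`, and
`X (j, i) ↦ X (j, i)` for the other slots. [folklore] -/
def sbProj (p : MatIdx (m + 2) × MatIdx (m + 2)) : MvPolynomial (sbVar m) ℂ :=
  if h0 : p.1 = sbJ0 m then
    (if (ofLex p.2).1 = (ofLex p.2).2 then X (Sum.inl (Sum.inl ())) else 0)
  else if h1 : p.1 = sbJ1 m then
    (if (ofLex p.2).2 = Fin.last (m + 1) then X (Sum.inr (Sum.inl (ofLex p.2).1))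
      else if ((ofLex p.2).1 : ℕ) = (ofLex p.2).2 + 1 then X (Sum.inl (Sum.inr ())) else 0)
  else X (Sum.inr (Sum.inr ⟨p, not_or.mpr ⟨h0, h1⟩⟩))

/-- Each coordinate of the projection is a linear form (a variable or zero). [folklore] -/
theorem sbProj_isHomogeneous (p : MatIdx (m + 2) × MatIdx (m + 2)) :
    (sbProj m p).IsHomogeneous 1 := by
  unfold sbProj
  split_ifs <;> first | exact isHomogeneous_X _ _ | exact isHomogeneous_zero _ _ _

/-- The section of the projection: slice coordinates of a point in normal form. [folklore] -/
def sbSec (y : MatIdx (m + 2) × MatIdx (m + 2) → ℂ) : sbVar m → ℂ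
  | Sum.inl (Sum.inl _) => y (sbJ0 m, toLex (0, 0))
  | Sum.inl (Sum.inr _) => y (sbJ1 m, toLex (1, 0))
  | Sum.inr (Sum.inl a) => y (sbJ1 m, toLex (a, Fin.last (m + 1)))
  | Sum.inr (Sum.inr p) => y p.1

/-- On points in normal form (slot `j₀` scalar, slot `j₁` a scalar multiple of a companion matrix:
constant subdiagonal, free last column) the projection followed by the section is the identity.
[folklore] -/
theorem eval_sbSec_sbProj {y : MatIdx (m + 2) × MatIdx (m + 2) → ℂ} {u₀ u₁ : ℂ}
    (hy0 : sbSlot y (sbJ0 m) = u₀ • (1 : Matrix (Fin (m + 2)) (Fin (m + 2)) ℂ))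
    (hy1 : ∀ c d : Fin (m + 2), (d : ℕ) + 1 < m + 2 →
      sbSlot y (sbJ1 m) c d = if (c : ℕ) = d + 1 then u₁ else 0) :
    (fun p => eval (sbSec m y) (sbProj m p)) = y := by
  have e0 : ∀ c d, y (sbJ0 m, toLex (c, d)) = if c = d then u₀ else 0 := fun c d => by
    rw [show y (sbJ0 m, toLex (c, d)) = sbSlot y (sbJ0 m) c d from rfl, hy0, Matrix.smul_apply,
      Matrix.one_apply, smul_eq_mul, mul_ite, mul_one, mul_zero]
  have e1 : ∀ c d : Fin (m + 2), (d : ℕ) + 1 < m + 2 →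
      y (sbJ1 m, toLex (c, d)) = if (c : ℕ) = d + 1 then u₁ else 0 := hy1
  funext p
  obtain ⟨j, i⟩ := p
  obtain ⟨⟨c, d⟩, rfl⟩ : ∃ cd : Fin (m + 2) × Fin (m + 2), toLex cd = i := ⟨ofLex i, toLex_ofLex i⟩
  unfold sbProj
  simp only [ofLex_toLex]
  by_cases h0 : j = sbJ0 m
  · subst h0
    rw [dif_pos rfl, e0 c d]
    split_ifs <;> simp [sbSec, e0]
  · rw [dif_neg h0]
    by_cases h1 : j = sbJ1 m
    · subst h1
      rw [dif_pos rfl]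
      by_cases hl : d = Fin.last (m + 1)
      · subst hl
        simp [sbSec]
      · have hd : (d : ℕ) + 1 < m + 2 := by have := Fin.val_lt_last hl; omega
        rw [if_neg hl, e1 c d hd]
        split_ifs <;> simp [sbSec, e1]
    · rw [dif_neg h1]
      simp [sbSec]

/-- Rescaling an invertible matrix to a unimodular one (`ℂ` has `N`-th roots). [folklore] -/
theorem sb_exists_smul_det_one (P : Matrix (Fin (m + 2)) (Fin (m + 2)) ℂ) (hP : P.det ≠ 0) :
    ∃ a : ℂ, (a • P).det = 1 := by
  obtain ⟨z, hz⟩ := IsAlgClosed.exists_pow_nat_eq P.det (show 0 < m + 2 by omega)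
  have hz0 : z ≠ 0 := by
    rintro rfl
    rw [zero_pow (by omega)] at hz
    exact hP hz.symm
  refine ⟨z⁻¹, ?_⟩
  rw [Matrix.det_smul, Fintype.card_fin, ← hz, inv_pow, inv_mul_cancel₀ (pow_ne_zero _ hz0)]

/-- Generic points (`h ≠ 0`) have a unimodular sandwich in the image of the slice: with
`K` the Krylov matrix of `x_{j₁} adj x_{j₀}`, `P = a K⁻¹`, `Q = b adj(x_{j₀}) K` make slot `j₀`
scalar and slot `j₁` `ab` times a companion matrix. [folklore: Krylov normal form] -/
theorem sb_exists_unimodular (x : MatIdx (m + 2) × MatIdx (m + 2) → ℂ) (hx : eval x (sbH m) ≠ 0) :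
    ∃ P Q : Matrix (Fin (m + 2)) (Fin (m + 2)) ℂ, P.det = 1 ∧ Q.det = 1 ∧
      ∃ z : sbVar m → ℂ, (fun p => eval z (sbProj m p)) = sbSand P Q x := by
  rw [eval_sbH] at hx
  set A₀ := sbSlot x (sbJ0 m) with hA₀
  set A₁ := sbSlot x (sbJ1 m) with hA₁
  set K := sbKry (A₁ * A₀.adjugate) with hK
  have hd : A₀.det ≠ 0 := left_ne_zero_of_mul hx
  have hKd : K.det ≠ 0 := right_ne_zero_of_mul hx
  obtain ⟨a, haP⟩ := sb_exists_smul_det_one m K⁻¹ (by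
    rw [Matrix.det_nonsing_inv, Ring.inverse_eq_inv']
    exact inv_ne_zero hKd)
  obtain ⟨b, hbQ⟩ := sb_exists_smul_det_one m (A₀.adjugate * K) (by
    rw [Matrix.det_mul, Matrix.det_adjugate]
    exact mul_ne_zero (pow_ne_zero _ hd) hKd)
  refine ⟨a • K⁻¹, b • (A₀.adjugate * K), haP, hbQ, _,
    eval_sbSec_sbProj m (u₀ := a * b * A₀.det) (u₁ := a * b) ?_ fun c d hd1 => ?_⟩
  · rw [sbSlot_sbSand, ← hA₀, Matrix.smul_mul, Matrix.mul_smul, Matrix.smul_mul, smul_smul,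
      Matrix.mul_assoc, ← Matrix.mul_assoc A₀, Matrix.mul_adjugate, Matrix.smul_mul, Matrix.one_mul,
      Matrix.mul_smul, Matrix.nonsing_inv_mul _ (isUnit_iff_ne_zero.mpr hKd), smul_smul]
    ring_nf
  · have h1 : sbSlot (sbSand (a • K⁻¹) (b • (A₀.adjugate * K)) x) (sbJ1 m) =
        (a * b) • (K⁻¹ * (A₁ * A₀.adjugate) * K) := by
      rw [sbSlot_sbSand, ← hA₁, Matrix.smul_mul, Matrix.mul_smul, Matrix.smul_mul, smul_smul,
        mul_comm b a]
      simp only [Matrix.mul_assoc]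
    rw [h1, Matrix.smul_apply, hK, sbKry_conj_apply _ (hK ▸ hKd) c d hd1]
    simp

/-- Density: a sandwich-invariant polynomial killed by the slice projection is zero
(`G · h` vanishes identically and `h ≠ 0`). [folklore: Zariski density] -/
theorem sb_eq_zero_of_aeval_sbProj (G : MvPolynomial (MatIdx (m + 2) × MatIdx (m + 2)) ℂ)
    (hG : ∀ P Q : Matrix (Fin (m + 2)) (Fin (m + 2)) ℂ, P.det = 1 → Q.det = 1 →
      aeval (sbSubst P Q) G = G)
    (hψ : aeval (sbProj m) G = 0) : G = 0 := by
  have hGH : G * sbH m = 0 := by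
    apply MvPolynomial.funext
    intro x
    rw [map_mul, map_zero]
    by_cases hx : eval x (sbH m) = 0
    · rw [hx, mul_zero]
    · obtain ⟨P, Q, hP, hQ, z, hz⟩ := sb_exists_unimodular m x hx
      rw [← hG P Q hP hQ, eval_aeval_sbSubst, ← hz, ← sb_eval_aeval, hψ, map_zero, zero_mul]
  exact (mul_eq_zero.mp hGH).resolve_right (sbH_ne_zero m)

/-- Count: degree-`D` forms in finitely many variables `τ` span a space of dimension at most
`(D+1)^(#τ)` (every exponent of a degree-`D` monomial is at most `D`). [folklore] -/
theorem sb_finrank_homogeneousSubmodule_le (τ : Type*) [Fintype τ] (D : ℕ) :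
    Module.finrank ℂ ↥(homogeneousSubmodule τ ℂ D) ≤ (D + 1) ^ Fintype.card τ := by
  classical
  let b : (τ → Fin (D + 1)) → MvPolynomial τ ℂ := fun g =>
    monomial (Finsupp.equivFunOnFinite.symm fun i => (g i : ℕ)) 1
  have hle : homogeneousSubmodule τ ℂ D ≤ Submodule.span ℂ (Set.range b) := by
    intro φ hφ
    rw [mem_homogeneousSubmodule] at hφ
    rw [φ.as_sum]
    refine Submodule.sum_mem _ fun d hd => ?_
    have hdeg : d.degree = D := by
      by_contra h
      exact (mem_support_iff.mp hd) (hφ.coeff_eq_zero h)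
    have hdi : ∀ i, d i < D + 1 := fun i => Nat.lt_succ_of_le (hdeg ▸ Finsupp.le_degree i d)
    have : monomial d (coeff d φ) = coeff d φ • b (fun i => ⟨d i, hdi i⟩) := by
      rw [smul_monomial, smul_eq_mul, mul_one]
      congr 1
      ext i
      simp
    rw [this]
    exact Submodule.smul_mem _ _ (Submodule.subset_span (Set.mem_range_self _))
  haveI : Module.Finite ℂ (Submodule.span ℂ (Set.range b)) :=
    Module.Finite.iff_fg.mpr (Submodule.fg_span (Set.finite_range b))
  calc Module.finrank ℂ ↥(homogeneousSubmodule τ ℂ D)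
      ≤ Module.finrank ℂ (Submodule.span ℂ (Set.range b)) := Submodule.finrank_mono hle
    _ ≤ Fintype.card (τ → Fin (D + 1)) := finrank_range_le_card b
    _ = (D + 1) ^ Fintype.card τ := by rw [Fintype.card_fun, Fintype.card_fin]

/-- The slice has at most `N⁴ - 2N² + 2N` variables (`#sbVar = 2 + N + (N² - 2) N²`). [folklore] -/
theorem card_sbVar_le : Fintype.card (sbVar m) ≤ (m + 2) ^ 4 - 2 * (m + 2) ^ 2 + 2 * (m + 2) := by
  have hc : Fintype.card (sbVar m) =
      2 + ((m + 2) + ((m + 2) * (m + 2) * ((m + 2) * (m + 2)) - 2 * ((m + 2) * (m + 2)))) := by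
    simp only [sbVar, Fintype.card_sum, Fintype.card_unit, Fintype.card_fin,
      Fintype.card_subtype_compl, Fintype.card_prod, Fintype.card_lex]
    rw [Fintype.card_congr (Equiv.prodSubtypeFstEquivSubtypeProd
        (p := fun j : MatIdx (m + 2) => j = sbJ0 m ∨ j = sbJ1 m)),
      Fintype.card_prod, Fintype.card_subtype_eq_or_eq_of_ne (sbJ0_ne_sbJ1 m), Fintype.card_lex,
      Fintype.card_prod, Fintype.card_fin]
  have h4 : (m + 2) ^ 4 = (m + 2) * (m + 2) * ((m + 2) * (m + 2)) := by ring
  have h2 : (m + 2) ^ 2 = (m + 2) * (m + 2) := by ring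
  rw [hc, h4, h2]
  have hle : 2 * ((m + 2) * (m + 2)) ≤ (m + 2) * (m + 2) * ((m + 2) * (m + 2)) :=
    Nat.mul_le_mul_right _ (by nlinarith)
  omega

/-- The slice bound at `N = m + 2`: the restriction `aeval sbProj` is injective on the
homogeneous sandwich invariants and lands in degree-`D` forms in the slice variables. [folklore] -/
theorem sb_finrank_le_pow_card (D : ℕ) :
    Module.finrank ℂ ↥(homogeneousSubmodule (MatIdx (m + 2) × MatIdx (m + 2)) ℂ D ⊓
        (⨅ (P : Matrix (Fin (m + 2)) (Fin (m + 2)) ℂ) (Q : Matrix (Fin (m + 2)) (Fin (m + 2)) ℂ)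
          (_ : P.det = 1) (_ : Q.det = 1),
          LinearMap.ker ((aeval (sbSubst P Q)).toLinearMap - LinearMap.id))) ≤
      (D + 1) ^ Fintype.card (sbVar m) := by
  haveI : Module.Finite ℂ ↥(homogeneousSubmodule (sbVar m) ℂ D) :=
    Module.Finite.iff_fg.mpr (homogeneousSubmodule_fg _ _ _)
  refine (LinearMap.finrank_le_finrank_of_injective
    (f := (((aeval (sbProj m)).toLinearMap.domRestrict _).codRestrict
      (homogeneousSubmodule (sbVar m) ℂ D) fun w => ?_)) ?_).trans
    (sb_finrank_homogeneousSubmodule_le _ D)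
  · -- the restriction preserves degree-`D` forms
    have h := ((mem_homogeneousSubmodule D w.1).mp (Submodule.mem_inf.mp w.2).1).aeval (sbProj m)
      (sbProj_isHomogeneous m)
    rw [one_mul] at h
    exact h
  · -- the restriction is injective on invariants
    rw [injective_iff_map_eq_zero]
    intro w hw
    refine Subtype.ext (sb_eq_zero_of_aeval_sbProj m _ (fun P Q hP hQ => ?_) (congrArg Subtype.val hw))
    have h2 := (Submodule.mem_inf.mp w.2).2
    simp only [Submodule.mem_iInf, LinearMap.mem_ker, LinearMap.sub_apply, sub_eq_zero] at h2
    exact h2 P Q hP hQ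

/-- **Slice bound (B1).** For `n ≥ 2` and every degree `D`, the degree-`D` polynomials on
`(Mat_n)^{n²}` (variables `X (j, i)`, row slot `j`, matrix position `i`) invariant under the
row-wise unimodular sandwich `A_j ↦ P A_j Q` (`det P = det Q = 1`) span a space of dimension at
most `(D+1)^(n⁴ - 2n² + 2n)`.  Proof: for `A` with `det A_{j₀} ≠ 0` and invertible Krylov matrix
`K` of `A_{j₁} adj A_{j₀}`, the unimodular pair `P = a K⁻¹`, `Q = b adj(A_{j₀}) K` puts `A` in the
linear slice `S` (slot `j₀` scalar, slot `j₁` a multiple of a companion matrix, other slots free;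
`2 + n + (n² - 2) n² ≤ n⁴ - 2n² + 2n` coordinates); these `A` are Zariski dense
(`h = det X_{j₀} · det K ≠ 0` at `A_{j₀} = 1`, `A_{j₁}` = shift), so restriction to `S`
(`aeval` of the coordinate projection) is injective on invariants (`MvPolynomial.funext`) and maps
degree-`D` forms to degree-`D` forms in the slice variables, of which there are at most
`(D+1)^{#S}` monomials. [folklore: Krylov / rational canonical form; Zariski density of
generic matrices] -/
theorem stub_sliceBound (n : ℕ) (hn : 2 ≤ n) (D : ℕ) :
    Module.finrank ℂ ↥(MvPolynomial.homogeneousSubmodule (MatIdx n × MatIdx n) ℂ D ⊓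
        (⨅ (P : Matrix (Fin n) (Fin n) ℂ) (Q : Matrix (Fin n) (Fin n) ℂ) (_ : P.det = 1) (_ : Q.det = 1),
          LinearMap.ker ((MvPolynomial.aeval fun p : MatIdx n × MatIdx n =>
              ∑ l : MatIdx n, (P (ofLex p.2).1 (ofLex l).1 * Q (ofLex l).2 (ofLex p.2).2) •
                (MvPolynomial.X (p.1, l) : MvPolynomial (MatIdx n × MatIdx n) ℂ)).toLinearMap -
            (LinearMap.id : MvPolynomial (MatIdx n × MatIdx n) ℂ →ₗ[ℂ] MvPolynomial (MatIdx n × MatIdx n) ℂ)))) ≤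
      (D + 1) ^ (n ^ 4 - 2 * n ^ 2 + 2 * n) := by
  obtain ⟨m, rfl⟩ : ∃ m, n = m + 2 := ⟨n - 2, by omega⟩
  exact (sb_finrank_le_pow_card m D).trans (Nat.pow_le_pow_right (Nat.succ_pos D) (card_sbVar_le m))

end

end Summit.ValiantsHypothesis.ValiantsHypothesis.Theorems.ValuativeFlip
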